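import Summits.Ventures.Crystal3D.Theorems.StickyWulffConstantCoaxialWallLawVicinalSplit
import Summits.Ventures.Crystal3D.Theorems.StickyWulffConstantCoaxialWallLawOfCensus
import Summits.Ventures.Crystal3D.Theorems.StickyWulffConstantGenericWallFloorOfP5Exhaustion
import HarnessLib

/-!
# Capstone: `CoaxialWallLaw` BY NAME ⇐ {E1, `StarPairFar`, the VICINAL CORE} = {E1, `StarPairFar`, the three debts
# coherent-twin / coherent-fault / incoherent} (crux `CoaxialWallLaw`, stmt-Ventures-19481, line `WallLedgerF`)

HONEST FRAMING. Venture `Summits/Ventures/Crystal3D` (cell `crystal3d-full`), helper `--supports` the crux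
`CoaxialWallLaw` of `route-Ventures-StickyWulffConstant` (REGISTERED line `WallLedgerF`).  LEAF capstone (imports the
route file through `…CoaxialWallLawOfCensus` for the skeleton composition; nothing should import this file).  Book-keeping only;
F-C1 not moved; NOT the crux: the vicinal core `CoaxialTwoSlabAdhesionVicinal` (`…VicinalCore`: triadic offsets, vicinal twins
`(√3/2) sin θ < 9/20`, level-⅓ offsets registered for every wide slot dominating an admissible axis — basal stacking-fault
staircases and vicinal coherent twins) is OPEN; `ExactOnly`(C12-55) / `P5Exhaustion` [E1, certified] and `StarPairFar`
[certified; kernel at computational grade, `StarFar.starPairFar_holds`] are inputs BY NAME.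

* **`coaxialWallLaw_of_vicinal`**, **`coaxialWallLaw_of_p5_vicinal`** — the crux from {E1, `StarPairFar`,
  `CoaxialTwoSlabAdhesionVicinal`} via `coaxialWallLaw_of_stubProps` and the landed `stub_affineSampleDeficit`;
* **`coaxialWallLaw_of_split`**, **`coaxialWallLaw_of_p5_split`** — the crux from {E1, `StarPairFar`} and the three typed debts
  `CoaxialTwoSlabAdhesionCoherentTwin`, `CoaxialTwoSlabAdhesionCoherentFault`, `CoaxialTwoSlabAdhesionIncoherent`
  (`…VicinalSplit`), so that census / THIN–THICK results plug in BY NAME.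
WHAT THIS IS NOT: a proof of the core; F-C1 not moved.
-/

noncomputable section

namespace Summit.Ventures.Crystal3D.Theorems

open Summit.Ventures.Crystal3D Finset
open Summit.Ventures.Crystal3D.Cruxes.CoaxialWallLaw.WallLedgerF (AffineSampleDeficit CoaxialTwoSlabAdhesion)
open Literature.MathematicalPhysics.StatisticalMechanics (fccStacking barlowStacking IsHaggSeq contactDeficiency)
open scoped InnerProductSpace

open scoped Classical in
/-- **The crux `CoaxialWallLaw` BY NAME from `ExactOnly`(C12-55), `StarPairFar` and the vicinal core.** -/
theorem coaxialWallLaw_of_vicinal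
    {s₀ : EuclideanSpace ℝ (Fin 3)} (hs₀ : s₀ ∈ fccSlots)
    (hcert : ExactOnly 0 (fccSlots.filter fun w => 0 < ⟪w, s₀⟫_ℝ)) (hSP : StarPairFar)
    (hcore : CoaxialTwoSlabAdhesionVicinal) :
    Summit.Ventures.Crystal3D.Theses.StickyWulffConstant.CoaxialWallLaw :=
  coaxialWallLaw_of_stubProps Summit.Ventures.Crystal3D.Theorems.stub_affineSampleDeficit
    (coaxialTwoSlabAdhesion_of_vicinal hs₀ hcert hSP hcore)

/-- **The crux `CoaxialWallLaw` BY NAME from `P5Exhaustion` (E1), `StarPairFar` and the vicinal core.** -/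
theorem coaxialWallLaw_of_p5_vicinal (hE1 : P5Exhaustion) (hSP : StarPairFar)
    (hcore : CoaxialTwoSlabAdhesionVicinal) :
    Summit.Ventures.Crystal3D.Theses.StickyWulffConstant.CoaxialWallLaw := by
  obtain ⟨s₀, hs₀, hcert⟩ := exactOnly_star_of_p5Exhaustion hE1
  exact coaxialWallLaw_of_vicinal hs₀ hcert hSP hcore

open scoped Classical in
/-- **The crux `CoaxialWallLaw` BY NAME from `ExactOnly`(C12-55), `StarPairFar` and the three typed debts.** -/
theorem coaxialWallLaw_of_split
    {s₀ : EuclideanSpace ℝ (Fin 3)} (hs₀ : s₀ ∈ fccSlots)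
    (hcert : ExactOnly 0 (fccSlots.filter fun w => 0 < ⟪w, s₀⟫_ℝ)) (hSP : StarPairFar)
    (h₁ : CoaxialTwoSlabAdhesionCoherentTwin) (h₂ : CoaxialTwoSlabAdhesionCoherentFault)
    (h₃ : CoaxialTwoSlabAdhesionIncoherent) :
    Summit.Ventures.Crystal3D.Theses.StickyWulffConstant.CoaxialWallLaw :=
  coaxialWallLaw_of_vicinal hs₀ hcert hSP (coaxialTwoSlabAdhesionVicinal_of_split h₁ h₂ h₃)

/-- **The crux `CoaxialWallLaw` BY NAME from `P5Exhaustion` (E1), `StarPairFar` and the three typed debts.** -/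
theorem coaxialWallLaw_of_p5_split (hE1 : P5Exhaustion) (hSP : StarPairFar)
    (h₁ : CoaxialTwoSlabAdhesionCoherentTwin) (h₂ : CoaxialTwoSlabAdhesionCoherentFault)
    (h₃ : CoaxialTwoSlabAdhesionIncoherent) :
    Summit.Ventures.Crystal3D.Theses.StickyWulffConstant.CoaxialWallLaw := by
  obtain ⟨s₀, hs₀, hcert⟩ := exactOnly_star_of_p5Exhaustion hE1
  exact coaxialWallLaw_of_split hs₀ hcert hSP h₁ h₂ h₃

end Summit.Ventures.Crystal3D.Theorems

end
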